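import HarnessLib.Audit.LibrarySuggestionsDenyListCorCM
import Summits.HodgeConjecture.HodgeConjecture.Theorems.F0D9opRoad2Body
import Summits.HodgeConjecture.HodgeConjecture.Theorems.F0D9opRoad2Mod
import Summits.HodgeConjecture.HodgeConjecture.Theorems.F0P6qTameLevelQuotient
import Literature.AlgebraicGeometry.Motives.IntegralModelTwoSectionFibreIdentityAt

/-!
# `F0D9opRoad2` — ★ RE-HOME (K6 «MAIN + PARENT» row; rung-0 re-homing, LEAD F0P6-plan «M-72»∕«M-139a»∕«M-140» (4); desk F0P6a-plan (g7) cut sheet v9) of the crux workfile `Lines/F0_D9opRoad2.lean`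

**SIZE-LINT SPLIT ×6** (`Theorems/` files with proofs are ≤ 400 lines): parts `Theorems/F0D9opRoad2Boundary.lean` → `Theorems/F0D9opRoad2Pen.lean` → `Theorems/F0D9opRoad2PenCongruence.lean` → `Theorems/F0D9opRoad2Descent.lean` → `Theorems/F0D9opRoad2Doors.lean` → `Theorems/F0D9opRoad2.lean`, each importing the previous, cut at declaration boundaries of `Lines/F0_D9opRoad2.lean`; namespaces AND sections KEPT and re-opened per part (with their `open`∕`variable` lines replayed verbatim); the options preamble is repeated. This is PART 1.

This `Theorems/` module is the TREE BYTES of `Summits/HodgeConjecture/HodgeConjecture/Cruxes/HLiu418/Lines/F0_D9opRoad2.lean` (edition of record ED. 8 «PWcore PAID», tree sha16 09709f616d3d0592, 1676 l.,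
code-`sorry`-free, 0 sockets) with the NAMESPACE KEPT — `Summit.HodgeConjecture.HodgeConjecture.Cruxes.HLiu418.F0D9opRoad2` — so that every fully-qualified name is UNCHANGED (no FQN moves except the ONE private-to-this-cone lemma retired by the (d1) dedup pre-cure below, 0 downstream bytes; outside reader:
socket `Lines/F0_AlbCm.lean` ED. 13 :337 `stub_D9op := …F0D9opRoad2.stub_D9op_holds` (FQN kept ★-side ⇒ resolves through the import; no alias needed)).  Statement AND proof bytes of every declaration, docstrings included, are the workfile՚s; the only edits are (a) this re-headed module docstring,
(b) the 3 `Lines` imports switched to their ★ re-homed twins (bare `import` lines — farm header canonical; provenance listed under «Import provenance» below; NO `Cruxes/…/Lines` import survives — NO-CROSS-IMPORT, «M-72» (3)), and (c) the non-import hunk(s) forced by (b) ∕ by the (d1) pre-cure: tree :535 `(finsum_map_geomReductionMap_map_eq_of_isOpenImmersion_specialFibre_at 𝒮 𝒯 π₁ π₂` → `(Literature.AlgebraicGeometry.Motives.IntegralModel.finsum_map_geomReductionMap_map_eq_of_isOpenImmersion_specialFibre_at 𝒮 𝒯 π₁ π₂`; tree :1248 `  modv3_of_core_quot stub_PWcore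 stub_MODquot` → `  modv3_of_core_quot Summit.HodgeConjecture.HodgeConjecture.Cruxes.HLiu418.F0P6aModuliDatum.pwcore_holds
    Summit.HodgeConjecture.HodgeConjecture.Cruxes.HLiu418.F0P6qTameLevelQuotient.quot_holds` (same constants under their importable ★ names; see the cut sheet for why each is a pure re-pointing).
(d) (d1) «M-142e» DEDUP PRE-CURE (LEAD F0P6-plan (g6) standing rule; desk pre-scan + `rfl` type-identity probe `F0/P6/F0P6a-plan/g7/d1/D1Probe.parent.v1.F0P6a-plan-g7.lean`): tree :348–:413 deleted (5 marker lines) — the duplicate local theorem is RETIRED in favour of its landed, importable Literature twin (FQN written at the call site; `import Literature.AlgebraicGeometry.Motives.IntegralModelTwoSectionFibreIdentityAt` added bare in the root part; decl count 51 → 50); no other declaration touched.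
(g) «M-150f» (B) EARLY SPLIT + «M-150h» CURE (ii) (LEAD F0P6-plan (g7) 2026-09-03T02:59:20Z ∕ 03:11:01Z; D-0071): the ★ MAIN import `…Theorems.F0P6aModuliDatum` is NOT in this ROOT header — it is the 2nd import of PART 5 `Theorems/F0D9opRoad2Doors.lean`, the only part that reads MAIN; THREE declarations of the workfile are RETIRED ★-side by the `dedup.landed` rule (gate dry-run B-p04 (g52) 03:04:43Z + LEAD forecast): the by-term aliases `stub_PWcore := …F0P6aModuliDatum.pwcore_holds` (tree :86–:90) and `stub_MODquot := …F0P6qTameLevelQuotient.quot_holds` (:92–:97), and the 0-reader restatement `stub_deg : HeckeDegreeSplitPlace` (:110–:123, TYPE token-identical to ★ `…F0P6aPointwiseFrobenius.deg_holds`) — a 2-line `--` marker stands at each site; their ONE code reader `stub_MODv3` (PART 5) is re-spelled BODY-ONLY `:= modv3_of_core_quot …F0P6aModuliDatum.pwcore_holds …F0P6qTameLevelQuotient.quot_holds` (statement untouched); the three NAMES of record `…F0D9opRoad2.stub_PWcore ∕ stub_MODquot ∕ stub_deg` are restored HUB-side as by-name aliases in the `Lines/F0_D9opRoad2.lean` ED.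 9 shim (crux workfiles are outside the Theorems dedup lint), so every FQN of the ED. 6∕7∕8 «PAID BY NAME» history still resolves; declaration census tree 51 → ★ chain 47 (−1 (d1) retiree, −3 cure (ii)); parts 1–4 do not import MAIN and may be filed before ★ MAIN exists; parts 5–6 after ★ MAIN LAST is ACCEPTED + served.
It asserts nothing beyond what the workfile already proves; every kept head is [propext, Classical.choice, Quot.sound] on the tree bytes.
After this file is ★ the `Lines/` workfile becomes ED. 9 = a one-import SHIM of it (a `crux write` on the LEAD՚s word, in ONE request with the other K6 shims over the reverse closure),
so no environment ever holds two copies of a declaration.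
HC_CM is proved only modulo the printed citations (2 remaining named inputs: hLiu418 = stmt-HodgeConjecture-24832, h413 = stmt-HodgeConjecture-24833) until rung 0 closes; a re-home is count-neutral.

## Import provenance (K6 switch map; the `import` lines above are bare on purpose — a trailing comment makes the farm router bypass header routing)
- ★ `…Theorems.F0D9opRoad2Body` ← was `…Lines.F0D9opRoad2Body` — ★ K4 twin p850973 (+ Letters∕Desk∕Gamma by import; was the `Lines.F0D9opRoad2Body` shim)
- ★ `…Theorems.F0D9opRoad2Mod` ← was `…Lines.F0D9opRoad2Mod` — ★ K4 twin p851028 (was the `Lines.F0D9opRoad2Mod` shim)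
- ★ `…Theorems.F0P6qTameLevelQuotient` ← was `…Lines.F0_P6q_TameLevelQuotient` — ★ K4 twin p851062: `quot_holds` (FQN kept; read :97)
- (moved to PART `Theorems/F0D9opRoad2Doors.lean`, its 2nd import — «M-150f» (B)) ★ `…Theorems.F0P6aModuliDatum` ← was `…Lines.F0_P6a_ModuliDatum` — ★ K6 twin MAIN (LAST part = stem; this sheet): `pwcore_holds` (FQN kept; read :90)
- `Literature.AlgebraicGeometry.Motives.IntegralModelTwoSectionFibreIdentityAt` ADDED — (d1) «M-142e» pre-cure (i): hosts the landed twin of the lemma retired at tree :363 (see the marker comment at the old `section GenericAt`)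


## Workfile header comments (verbatim, between the imports and the module docstring in the tree)

`Lines/F0_D9opRoad2.lean` EDITION 5 «L-P6-0 BOUNDARY» (A-plan2 (g22) candidate, 2026-09-01; director s872 (3); P6 = GO 12:08:47Z): HOME desk v0.9
`F0/P5a/F0_D9opRoad2.ed5.desk.v0.9.F0P5a-p02g4.lean` 90eb051af3352829 (ED. 5.3, REF1 countersigned 2026-08-31T06:11Z) CUT IN TWO at the clean seam :1139∕:1141
because 279 628 B exceeds the 200 000 B `crux write` cap: the letters + `RecordLemmas` live in the imported BODY `Lines/F0D9opRoad2Body.lean` (desk :73–:1139);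
this file = namespace∕opens re-opened (desk :88–:104, :493–:497) + desk :1141–:2726 VERBATIM. OUT: ED. 4՚s sorry `stub_C3` (now `:= stub_C3_of_v3 stub_MODv3 stub_desc`,
derived); IN: the ONE sorry `stub_MOD : RecordCurveCongruenceCorrespondenceCofinal` = the MOD boundary (P6). HEAD unchanged: `stub_D9op_holds : CorD9OnMOp CMgsm XMgsm`
BY NAME for registry `Lines/d6_cm_curve.lean` `stub_D9op`. The α∕β′∕γ′ three-stub split of `stub_MOD` is ED. 6 (P6 LEAD ruling). No registry act: BY WRITE on 24832.
EDITION 6 «door P″» (P6 LEAD F0P6-plan (g0) RULING M-1 (B) 2026-09-01T13:15:28Z; director s894; mechanical cut v2 by registrar A-plan1 (g24) on tree ED. 5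
03769e66bb6d5309): + `import …Lines.F0D9opRoad2Mod` (LEAD WRITE-3: `RecordModuliPointwiseCoreCofinal`, `RecordTameLevelQuotientModel`, `pw_of_core_quot`,
`modv3_of_core_quot`); OUT `stub_MOD` (door R leaves the cone — `modv3_of_modv2`∕`stub_Q`∕`stub_deg`∕`stub_full` stay PROVED, door R stays enterable);
IN the TWO boundary stubs `stub_PWcore : RecordModuliPointwiseCoreCofinal` (moduli core; P6a + organs P6b∕c∕d) and `stub_MODquot : RecordTameLevelQuotientModel`
(tame level-quotient packaging; hand M-Q); `stub_MODv3 := modv3_of_core_quot stub_PWcore stub_MODquot`; code-`sorry` 1 → EXACTLY 2; head `stub_D9op_holds` unchanged BY NAME.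
EDITION 7 «MODquot PAID» (P6 LEAD F0P6-plan (g0) RULING «M-4» (4) 2026-09-01T13:57:40Z; mechanical cut by registrar A-plan1 (g25) on tree ED. 6 dea8ee9ffca693f9):
+ `import …Lines.F0_P6q_TameLevelQuotient` (sorry-free sub-line «M-Q», A-p14 (g30) + A-p03 (g27), tree 095a9dabe50403a6; F0P6-ref1 BOX «P6q-1» GREEN 13:54:15Z);
`stub_MODquot` ↦ the DERIVED theorem `:= F0P6qTameLevelQuotient.quot_holds` (PROVED BY NAME, axioms TRIO); nothing else moves; code-`sorry` 2 → EXACTLY 1 = {`stub_PWcore`};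
`stub_MODv3 := modv3_of_core_quot stub_PWcore stub_MODquot` and the head `stub_D9op_holds` unchanged BY NAME. No registry act: BY WRITE on 24832.
EDITION 8 «PWcore PAID» (P6 LEAD F0P6-plan (g0) «M-5» 2026-09-01T14:12:15Z; mechanical cut by registrar A-plan1 (g25) on tree ED. 7 eea84fdcb55005ed):
+ `import …Lines.F0_P6a_ModuliDatum` (sub-line «P6a-2» moduli datum, desk F0P6a-plan (g0), tree 0fd3fb4ee730ec02; written by desk F0P6a-plan (g0) commit ee355b65853d, 337 l., sorries {stub_UP :322, stub_GALQ :329}, head pwcore_holds :334 := pwcore_of_up_galq stub_UP stub_GALQ; F0P6-ref1 BOX «P6a-2» v2 GREEN (LEAD M-4c∕M-6));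
`stub_PWcore` ↦ the DERIVED theorem `:= F0P6aModuliDatum.pwcore_holds` (PROVED BY NAME over the sub-line; the sub-line՚s own named stubs carry what remains); nothing else moves;
code-`sorry` in THIS file 1 → EXACTLY 0; `stub_MODv3 := modv3_of_core_quot stub_PWcore stub_MODquot` and the head `stub_D9op_holds` unchanged BY NAME. No registry act: BY WRITE on 24832.

## Original module docstring (verbatim)
## SUB-LINE `Cruxes/HLiu418/Lines/F0_D9opRoad2` — EDITION 8 «PWcore PAID» (= ED. 7 «MODquot PAID» with `stub_PWcore` PROVED BY NAME over the sub-line `F0_P6a_ModuliDatum`; ED. 7 = ED. 6 «door P″» with `stub_MODquot` PROVED BY NAME over the sub-line `Lines/F0_P6q_TameLevelQuotient.lean`; parent file; the letters are in `Lines/F0D9opRoad2Body.lean`)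

ED. 8 «PWcore PAID» (P6 LEAD F0P6-plan (g0) «M-5» 2026-09-01T14:12:15Z): the moduli-core boundary stub `stub_PWcore : RecordModuliPointwiseCoreCofinal` of ED. 6∕7
is now the DERIVED theorem `stub_PWcore := F0P6aModuliDatum.pwcore_holds` over the imported sub-line `Lines/F0_P6a_ModuliDatum.lean` (tree 0fd3fb4ee730ec02;
desk F0P6a-plan (g0); its head `pwcore_holds : F0D9opRoad2Mod.RecordModuliPointwiseCoreCofinal` is assembled from the sub-line՚s own registered-to-be stubs, which
now carry the in-house provenance of books §8.4 M-2 until they close). This file has NO code-`sorry` left: the boundary chain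
`stub_D9op_holds ⟸ stub_C3 ⟸ stub_MODv3 := modv3_of_core_quot stub_PWcore stub_MODquot` is by name over two imported sub-lines. Door R and the retained
ED. 4 organs are unchanged.

ED. 7 «MODquot PAID» (P6 LEAD RULING «M-4» (4), 2026-09-01): the tame level-quotient boundary stub `stub_MODquot : RecordTameLevelQuotientModel` of ED. 6
is now the DERIVED theorem `stub_MODquot := F0P6qTameLevelQuotient.quot_holds` over the imported sorry-free sub-line `Lines/F0_P6q_TameLevelQuotient.lean`
(hand M-Q, A-p14 (g30) + A-p03 (g27): the level-quotient action on the record system ★ `RecordSystemGS`, geometric-quotient recognition, and the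
smooth proper tame quotient of the integral model — 7 theorems, 0 `sorry`, axioms TRIO; F0P6-ref1 BOX «P6q-1» GREEN).  The ONE live `sorry` of the line is
`stub_PWcore : RecordModuliPointwiseCoreCofinal` (the MODULI CORE — P6 wave 2, sub-line F0-P6a + organs F0-P6b∕c∕d); `stub_MODv3 :=
modv3_of_core_quot stub_PWcore stub_MODquot` and everything below it stay kernel-checked down to the head `stub_D9op_holds : CorD9OnMOp CMgsm XMgsm`
BY NAME (registry `Lines/d6_cm_curve.lean` `stub_D9op`).  HC_CM is proved only modulo the 7 printed citations until rung 0 closes; this edition changes no count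
of printed inputs (M-3 `stub_MODquot` ↦ PROVED-INHOUSE in the MOD package).

ED. 6 «door P″» (P6 LEAD RULING M-1, 2026-09-01): the print-shape boundary `stub_MOD : RecordCurveCongruenceCorrespondenceCofinal` (door R) LEAVES THE
CONE and the road-neutral door `stub_MODv3` is entered through P″: `stub_MODv3 := modv3_of_core_quot stub_PWcore stub_MODquot` over the imported module
`Lines/F0D9opRoad2Mod.lean` (the pointwise-Frobenius letter, the two ∃-packages and the kernel-checked glue `pw_of_core_quot` ∕ `modv3_of_core_quot`, TRIO).
The TWO live `sorry`s of the line are now `stub_PWcore : RecordModuliPointwiseCoreCofinal` (the MODULI CORE: an RSZ∕Carayol-type smooth proper model at a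
cofinal neat level with its pointwise Frobenius datum — P6 wave 2, sub-line F0-P6a + organs F0-P6b∕c∕d) and `stub_MODquot : RecordTameLevelQuotientModel`
(the TAME LEVEL-QUOTIENT packaging — ★-provable, hand M-Q); `modv3_of_modv2`, `stub_Q`, `stub_deg`, `stub_desc`, `stub_full` stay PROVED (door R enterable).
Everything below the two stubs is kernel-checked down to the head `stub_D9op_holds : CorD9OnMOp CMgsm XMgsm` BY NAME (registry `Lines/d6_cm_curve.lean` `stub_D9op`).

ED. 5 = HOME desk v0.9 (ED. 5.3) of sub-cell F0∕P5a, registered on the P6 word (21-frontier 2026-09-01T12:08:47Z; director s872): the pole `stub_C3 :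
letter_D8_heckeReductionPointwise` of ED. 4 becomes the DERIVED theorem `stub_C3 := stub_C3_of_v3 stub_MODv3 stub_desc`, with `stub_MODv3 :=
modv3_of_modv2 stub_MOD stub_Q stub_deg stub_full` and `stub_Q`∕`stub_deg`∕`stub_desc`∕`stub_full` PROVED here; the ONE live `sorry` of the line is
`stub_MOD : RecordCurveCongruenceCorrespondenceCofinal` (type defined in the BODY module) = the MOD programme՚s boundary in print shape
([Liu2021] Prop. D.8 (1)–(3) + proof of Cor. D.9; [Carayol1986] Prop. 10.3).  Everything below `stub_MOD` is kernel-checked down to the head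
`stub_D9op_holds : CorD9OnMOp CMgsm XMgsm` BY NAME.  WHY THIS LINE: a moduli description of `M⋆` exists only at neat level, so every road of P6
proves the congruence at a cofinal neat `Kc` and descends along the tame quotient — the boundary asks for exactly that and nothing road-specific
beyond print՚s mechanism; the road-neutral door `stub_MODv3` is the documented second entry (Road P″).
HC_CM is proved only modulo the 7 printed citations (2 remaining: hLiu418, h413) + the MOD package until rung 0 closes. -/


namespace Summit.HodgeConjecture.HodgeConjecture.Cruxes.HLiu418.F0D9opRoad2

set_option linter.dupNamespace false  -- `Summit.HodgeConjecture.HodgeConjecture.…` BY DESIGN (D-0017), as in `Lines/d6_cm_curve.lean`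

open CategoryTheory NumberField IsDedekindDomain MulAction
open scoped Matrix MonObj CategoryTheory.Obj
open MonoidalCategory
open Summit.HodgeConjecture.CorCM.Lines.A3Liu418
open Literature.AlgebraicGeometry.Motives (AbelianVariety)
open Literature.AlgebraicGeometry.Motives.AbelianVariety (rationalTateModuleMap frobeniusHom zsmul_eq_zsmul_trace_comp_of_pin
  exists_finite_forall_exists_goodReductionAt_homReduction_tateSpecialisation)
open Literature.NumberTheory.GaloisRepresentations
open Literature.NumberTheory.Automorphic Literature.NumberTheory.Automorphic.UnitaryGroup
open Literature.AlgebraicGeometry.ShimuraVarieties.UnitaryCanonicalModel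
open Literature.NumberTheory.Automorphic.Liu2021.AppendixC
open Literature.AlgebraicGeometry.Motives (AlgPoints IntegralModel frobeniusOver SchemeOver)
open Literature.NumberTheory.DiophantineGeometry (geomResidueField)

section Edition5Desk

open Literature.NumberTheory.EllipticCurves (genericFibre)
open Literature.NumberTheory.DiophantineGeometry (specialFibreFunctor)
open IsLocalRing (closedPoint)

-- «M-150h» cure (ii): `stub_PWcore : RecordModuliPointwiseCoreCofinal := …F0P6aModuliDatum.pwcore_holds` (tree :86–:90) is RETIRED ★-side — a by-term alias of the landed
-- ★ `…F0P6aModuliDatum.pwcore_holds` (`dedup.landed`); its one reader `stub_MODv3` (PART 5 `Doors`) reads that FQN body-only; the NAME stays hub-side in the `Lines/F0_D9opRoad2.lean` ED. 9 shim.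

-- «M-150h» cure (ii): `stub_MODquot : RecordTameLevelQuotientModel := …F0P6qTameLevelQuotient.quot_holds` (tree :92–:97) is RETIRED ★-side — a by-term alias of the landed
-- ★ `…F0P6qTameLevelQuotient.quot_holds` (`dedup.landed`, gate dry-run B-p04 (g52) 03:04:43Z); reader `stub_MODv3` re-spelled body-only; the NAME stays hub-side in the ED. 9 shim.

/-- **STUB `stub_Q : HeckeSumReindexing`** — record half of the reindexing (L); INHABITED on the HOME desk `Gamma3Q-PROOF-DESK.v0.F0P5a-p05g3.lean`
263db0a2 (`heckeSumReindexing_holds`, axioms TRIO, re-homed to `Lines.D6CmCurveBody` 2a13d569 rc 0); pasted here at registration.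
(print: Liu2021, Lemma C.18; Milne2005ShimuraVarieties, §13 p. 118–119) -/
theorem stub_Q : HeckeSumReindexing := by
  intro F _ _ _ _ ι₁ Jstar K₀ S hU7ₛ hJ hJu K w hw K₁ hle ht hK₁ N hNK r₁ hr₁ hrN₁ x
  -- fully-qualified `AppendixC.` names: `open Summit.HodgeConjecture.CorCM.Lines.A3Liu418` (file head) also exports a bundled-`CMField`
  -- `recordHeckeTranslateGS`; the overload makes the short names time out at `whnf` (F0P5a-p05 (g3) bisection, ED. 5 desk v0.2)
  exact RecordLemmas.exists_heckeSum_lift S hU7ₛ (S.isLevelQuotient_holds hJ ((Matrix.isUnit_iff_isUnit_det _).mp hJu)) _ K K₁ N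
    hle hK₁ hNK r₁ hr₁ hrN₁ (Literature.NumberTheory.Automorphic.Liu2021.AppendixC.isHeckeTranslate_recordHeckeTranslateGS S hU7ₛ _ K₁ K ht)
    (fun α => Literature.NumberTheory.Automorphic.Liu2021.AppendixC.isHeckeTranslate_recordHeckeTranslateGS S hU7ₛ (r₁ α) N K (hrN₁ α)) x

-- «M-150h» cure (ii): `stub_deg : HeckeDegreeSplitPlace` (tree :110–:123, a 3-clause term; 0 readers) is RETIRED ★-side — its TYPE is token-identical to the landed
-- ★ `…F0P6aPointwiseFrobenius.deg_holds` (`dedup.landed`, same dry-run); the NAME stays hub-side in the ED. 9 shim as `:= …F0P6aPointwiseFrobenius.deg_holds`.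

/-- **STUB `stub_desc : HeckeMultisetLevelDescent`** — record descent (M); F0P5a-p05 (g3) row (b5) HOME desk over the generic coset bijection
(F0P5a-p02 (g3) row (b6)); pasted here at registration.
(print: Milne2005ShimuraVarieties, §5 p. 57–58, Thm. 13.6) -/
theorem stub_desc : HeckeMultisetLevelDescent := by
  intro F _ _ _ _ ι₁ Jstar K₀ S hU7ₛ hJ hJu K w hw hgl hK Kc hKcK hKc N hNK r₁ hr₁ hrN₁ r₂ hr₂ hrN₂ x
  exact RecordLemmas.exists_heckeMultisetLevelDescent S (S.isLevelQuotient_holds hJ ((Matrix.isUnit_iff_isUnit_det _).mp hJu))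
    (Literature.NumberTheory.Automorphic.Liu2021.AppendixC.recordHeckeTranslateGS S hU7ₛ)
    (Literature.NumberTheory.Automorphic.Liu2021.AppendixC.isHeckeTranslate_recordHeckeTranslateGS S hU7ₛ) _ _ hKcK hNK
    (UnitaryGroup.exists_orbitEquiv_heckeElementAt_symm_of_le hK hKc hKcK ⟨w, rfl⟩ (IsCMField.complexConj_ne_one F) hJ hw
      (UnitaryGroup.isUnit_placeForm Jstar hJu w) hgl (HeckeCharacter.uniformizer F w) 1)
    (UnitaryGroup.exists_orbitEquiv_heckeElementAt_symm_of_le hK hKc hKcK ⟨w, rfl⟩ (IsCMField.complexConj_ne_one F) hJ hw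
      (UnitaryGroup.isUnit_placeForm Jstar hJu w) hgl (HeckeCharacter.uniformizer F w) 2)
    r₁ hr₁ hrN₁ r₂ hr₂ hrN₂ x

namespace FullLemmas

/-! (b12) NEAT-FREE desk 9ec35e9008120c74 ∕ v0.1 (F0P5a-p02 (g3)) §B–§D, line-local namespace (a later Literature filing cannot clash by FQN);
the rational element is named `grat` (the token `γ` is notation in this file's scope). -/

open AlgebraicGeometry Literature.AlgebraicGeometry.Motives Literature.AlgebraicGeometry.ShimuraVarieties
open Literature.NumberTheory.Automorphic.ShimuraDissection
open scoped ComplexOrder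

variable {L : Type} [Field L] [NumberField L] [IsCMField L] {Jstar : Matrix (Fin 2) (Fin 2) L} {τ : L →+* ℂ}
  {K₀ : C5.OpenCompactSubgroup ↥(finAdelic (↥(maximalRealSubfield L)) L (IsCMField.complexConj L) 2 Jstar)}

/-! ## §B Freeness on complex points: a translate `T_{k⁻¹}` fixing a complex point of `M⋆_N` has `k ∈ N` -/

/-- **FREENESS (record, complex points)**: for small levels `N ≤ K` of a `RecordSystemGS` and automorphisms `act k` of `M⋆_N`
acting as the translates `[v, aN] ↦ [v, ak⁻¹N]` (`IsHeckeTranslate N N k⁻¹`, the u4 action), a complex point fixed by `act k` forces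
`k ∈ N`: `[v, ak⁻¹] = [v, a]` gives a rational `grat` fixing the line of `v` with `a⁻¹γa ∈ N k ⊆ K`, hence `grat = 1` (§A) and `k⁻¹ ∈ N`.
[cite: Milne2005ShimuraVarieties, §5 (5.1) p. 56, Lemma 5.13 p. 57] [cite: Deligne1979ShimuraVarieties, 2.1.2–2.1.4] -/
theorem coe_mem_of_map_act_eq (S : RecordSystemGS L Jstar τ K₀) {N K : C5.SmallLevel K₀} (hNK : N ≤ K)
    {act : ↥K.1.1 →* Aut (S.M.obj N)}
    (hact : ∀ k : ↥K.1.1, S.IsHeckeTranslate N N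
      ((k : ↥(finAdelic (↥(maximalRealSubfield L)) L (IsCMField.complexConj L) 2 Jstar))⁻¹) (act k).hom)
    (k : ↥K.1.1) (P : letI : Algebra L ℂ := τ.toAlgebra; ComplexPoints (S.M.obj N))
    (h : letI : Algebra L ℂ := τ.toAlgebra; AlgPoints.map (act k).hom P = P) :
    (k : ↥(finAdelic (↥(maximalRealSubfield L)) L (IsCMField.complexConj L) 2 Jstar)) ∈ N.1.1 := by
  letI : Algebra L ℂ := τ.toAlgebra
  have hNK' : (N.1.1 : Subgroup _) ≤ K.1.1 := hNK
  obtain ⟨v, hv, a, rfl⟩ := S.exists_eq_pts_symm_mk N P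
  rw [RecordSystemGS.IsHeckeTranslate.map_ptsSymm_mk S (hact k) v hv a] at h
  have h1 := (S.pts N).symm.injective h
  rw [ShimuraSetGS.mk_eq_mk_iff] at h1
  obtain ⟨grat, c, hc, hcv, hgrat⟩ := h1
  rw [MulAction.Quotient.smul_coe, smul_eq_mul, QuotientGroup.eq] at hgrat
  -- `hgrat : (ι grat * a)⁻¹ * (a * k⁻¹) ∈ N`; so `a⁻¹ (ι grat)⁻¹ a ∈ N k ⊆ K`, and `a⁻¹ (ι grat) a ∈ K`
  have hmemK : a⁻¹ * rationalToFinAdelic (↥(maximalRealSubfield L)) L (IsCMField.complexConj L) 2 Jstar grat * a ∈ K.1.1 := by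
    have h2 : (a⁻¹ * (rationalToFinAdelic (↥(maximalRealSubfield L)) L (IsCMField.complexConj L) 2 Jstar grat)⁻¹ * a) *
        ((k : ↥(finAdelic (↥(maximalRealSubfield L)) L (IsCMField.complexConj L) 2 Jstar)))⁻¹ ∈ K.1.1 := by
      have e : (a⁻¹ * (rationalToFinAdelic (↥(maximalRealSubfield L)) L (IsCMField.complexConj L) 2 Jstar grat)⁻¹ * a) *
          ((k : ↥(finAdelic (↥(maximalRealSubfield L)) L (IsCMField.complexConj L) 2 Jstar)))⁻¹
          = (rationalToFinAdelic (↥(maximalRealSubfield L)) L (IsCMField.complexConj L) 2 Jstar grat * a)⁻¹ *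
            (a * ((k : ↥(finAdelic (↥(maximalRealSubfield L)) L (IsCMField.complexConj L) 2 Jstar)))⁻¹) := by group
      rw [e]; exact hNK' hgrat
    have h3 := K.1.1.mul_mem h2 k.2
    rw [inv_mul_cancel_right] at h3
    have h4 := K.1.1.inv_mem h3
    have e : (a⁻¹ * (rationalToFinAdelic (↥(maximalRealSubfield L)) L (IsCMField.complexConj L) 2 Jstar grat)⁻¹ * a)⁻¹
        = a⁻¹ * rationalToFinAdelic (↥(maximalRealSubfield L)) L (IsCMField.complexConj L) 2 Jstar grat * a := by group
    rwa [e] at h4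
  have hg1 : grat = 1 := S.eq_one_of_conj_mem_of_smul_mulVec_eq K grat a hmemK hv hcv
  rw [hg1, map_one, one_mul] at hgrat
  -- `hgrat : a⁻¹ * (a * k⁻¹) ∈ N`
  rw [inv_mul_cancel_left] at hgrat
  exact (Subgroup.inv_mem_iff _).1 hgrat


/-- **Full fibres of the level maps on geometric points** (the content of FULL with explicit binders): for small levels `K₁ ≤ Kc`
of a `RecordSystemGS` (`J⋆` hermitian non-degenerate) and any `w`, the fibre of `u′ : M⋆_{K₁}(Ω) → M⋆_{Kc}(Ω)` (`Ω = F̄_w`) over any `z`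
has exactly `[Kc : K₁]` points.  Proof: u4 at a sublevel `N′ ≤ K₁` normalised by `Kc` (★ `isLevelQuotient_holds`, ★ `exists_normal_le`);
lift `z` to `P ∈ M⋆_{N′}(Ω)` (★ p805003); the stabiliser of `P` in `Kc` lies in `N′` (§B on complex points, transported to `Ω` by ★
`AlgPoints.forall_map_eq_self_imp_of_forall`); count by ★ p810625 `natCard_setOf_map_eq_eq_index_of_stabilizer_le`.
[cite: Milne2005ShimuraVarieties, §5 p. 57 L7–12, Rem. 5.29 (c) p. 65] [cite: Deligne1979ShimuraVarieties, 2.7.1 (c)] -/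
theorem natCard_fibre_map_eq_relIndex {F : Type} [Field F] [NumberField F] [IsCMField F] {ι₁ : F →+* ℂ}
    {Jstar : Matrix (Fin 2) (Fin 2) F}
    {K₀ : C5.OpenCompactSubgroup ↥(finAdelic ↥(maximalRealSubfield F) F (IsCMField.complexConj F) 2 Jstar)}
    (S : RecordSystemGS F Jstar ι₁ K₀) (hJ : (Jstar.map (IsCMField.complexConj F))ᵀ = Jstar) (hJu : IsUnit Jstar)
    (Kc K₁ : C5.SmallLevel K₀) (hle : K₁ ≤ Kc) (w : HeightOneSpectrum (𝓞 F))
    (z : AlgPoints (S.M.obj Kc) (AlgebraicClosure (w.adicCompletion F))) :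
    Nat.card {y : AlgPoints (S.M.obj K₁) (AlgebraicClosure (w.adicCompletion F)) //
        AlgPoints.map (S.M.map (homOfLE hle)) y = z}
      = (K₁.1.1 : Subgroup ↥(finAdelic ↥(maximalRealSubfield F) F (IsCMField.complexConj F) 2 Jstar)).relIndex Kc.1.1 := by
  classical
  have hle' : (K₁.1.1 : Subgroup ↥(finAdelic ↥(maximalRealSubfield F) F (IsCMField.complexConj F) 2 Jstar)) ≤ Kc.1.1 := hle
  -- a sublevel `N′ ≤ K₁` normalised by `Kc`
  have hN := C5.SmallLevel.exists_normal_le Kc K₁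
  obtain ⟨N', hN'Kc, hN'K₁, hn'⟩ := hN
  have hN'K₁' : (N'.1.1 : Subgroup ↥(finAdelic ↥(maximalRealSubfield F) F (IsCMField.complexConj F) 2 Jstar)) ≤ K₁.1.1 := hN'K₁
  -- u4: the `Kc`- and `K₁`-actions on `M⋆_{N′}` and the two level quotients
  have hLQ : S.IsLevelQuotient := S.isLevelQuotient_holds hJ ((Matrix.isUnit_iff_isUnit_det _).mp hJu)
  have hLQc := hLQ hN'Kc (fun k hk n hn => hn' k hk n hn)
  obtain ⟨act, hact, hp⟩ := hLQc
  have hLQ₁ := hLQ hN'K₁ (fun k hk n hn => hn' k (hle' hk) n hn)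
  obtain ⟨act₁, hact₁, hq₁⟩ := hLQ₁
  -- (head-room cure, desk F0P6a-plan (g8): `let` + `rfl` instead of `set … with` — no context-abstraction pass)
  let Γ₁ : Subgroup ↥(Kc.1.1 : Subgroup ↥(finAdelic ↥(maximalRealSubfield F) F (IsCMField.complexConj F) 2 Jstar)) :=
    (K₁.1.1 : Subgroup ↥(finAdelic ↥(maximalRealSubfield F) F (IsCMField.complexConj F) 2 Jstar)).subgroupOf Kc.1.1
  have hΓ₁ : Γ₁ = (K₁.1.1 : Subgroup ↥(finAdelic ↥(maximalRealSubfield F) F (IsCMField.complexConj F) 2 Jstar)).subgroupOf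
      Kc.1.1 := rfl
  let Nn : Subgroup ↥(Kc.1.1 : Subgroup ↥(finAdelic ↥(maximalRealSubfield F) F (IsCMField.complexConj F) 2 Jstar)) :=
    (N'.1.1 : Subgroup ↥(finAdelic ↥(maximalRealSubfield F) F (IsCMField.complexConj F) 2 Jstar)).subgroupOf Kc.1.1
  have hNn : Nn = (N'.1.1 : Subgroup ↥(finAdelic ↥(maximalRealSubfield F) F (IsCMField.complexConj F) 2 Jstar)).subgroupOf
      Kc.1.1 := rfl
  haveI : Nn.Normal := C5.SmallLevel.normal_subgroupOf_of_heckeLE N' Kc hn'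
  haveI : Nn.FiniteIndex := C5.SmallLevel.finiteIndex_subgroupOf N' Kc
  have hNact : ∀ n ∈ Nn, act n = 1 := fun n hn =>
    RecordSystemGS.IsLevelQuotient.act_eq_one_of_mem hact n (Subgroup.mem_subgroupOf.1 hn)
  have hNΓ₁ : Nn ≤ Γ₁ := fun x hx => Subgroup.mem_subgroupOf.2 (hN'K₁' (Subgroup.mem_subgroupOf.1 hx))
  -- `M⋆_{N′} → M⋆_{K₁}` is a separated quotient by `Γ₁` acting through `act` (its own u4 action has the same members)
  have hq : IsSepQuotient (fun h : ↥Γ₁ => act (h : ↥(Kc.1.1 : Subgroup _))) (S.M.map (homOfLE hN'K₁)) := by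
    refine IsSepQuotient.of_forall_exists (act := fun k : ↥(K₁.1.1 : Subgroup _) => act₁ k) ?_ ?_ hq₁
    · intro h
      refine ⟨⟨((h : ↥(Kc.1.1 : Subgroup _)) : ↥(finAdelic ↥(maximalRealSubfield F) F (IsCMField.complexConj F) 2 Jstar)),
        Subgroup.mem_subgroupOf.1 h.2⟩, Iso.ext (S.heckeTranslate_unique (hact _) (hact₁ _))⟩
    · intro k
      exact ⟨⟨⟨(k : ↥(finAdelic ↥(maximalRealSubfield F) F (IsCMField.complexConj F) 2 Jstar)), hle' k.2⟩,
        Subgroup.mem_subgroupOf.2 k.2⟩, Iso.ext (S.heckeTranslate_unique (hact₁ _) (hact _))⟩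
  have hqr : S.M.map (homOfLE hN'K₁) ≫ S.M.map (homOfLE hle) = S.M.map (homOfLE hN'Kc) := by
    rw [← Functor.map_comp]
    rfl
  -- geometric hypotheses
  have hX : IsProjectiveOver (S.M.obj N') := S.projective N'
  have hsep : ∀ A : C5.SmallLevel K₀, IsSeparated (S.M.obj A).hom := fun A => by
    haveI : IsProper (S.M.obj A).hom := (S.projective A).isProper
    infer_instance
  haveI : LocallyOfFiniteType (S.M.obj N').hom := by
    haveI : IsProper (S.M.obj N').hom := (S.projective N').isProper
    infer_instance
  haveI : IsSeparated (S.M.obj N').hom := hsep N'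
  -- lift `z` to `M⋆_{N′}(Ω)` (re-ascribed to the ambient `Algebra F Ω` instance)
  have hlift := IsSepQuotient.surjective_map_geometric_of_finiteIndex
    (algebraMap F (AlgebraicClosure (w.adicCompletion F))) act Nn (S.M.map (homOfLE hN'Kc)) hX (hsep Kc) hNact hp z
  obtain ⟨P₀, hP₀⟩ := hlift
  set P : AlgPoints (S.M.obj N') (AlgebraicClosure (w.adicCompletion F)) := P₀ with hPdef
  have hP : AlgPoints.map (S.M.map (homOfLE hN'Kc)) P = z := hP₀
  -- FREENESS of `Kc/N′` at `P`: transport of §B from `ℂ` to `Ω`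
  have hfree : ∀ g : ↥(Kc.1.1 : Subgroup _), AlgPoints.map (act g).hom P = P → g ∈ Nn := by
    intro g hg
    rw [hNn, Subgroup.mem_subgroupOf]
    letI : Algebra F ℂ := ι₁.toAlgebra
    exact AlgPoints.forall_map_eq_self_imp_of_forall (act g).hom (AlgebraicClosure (w.adicCompletion F)) ℂ
      (fun Pc hPc => coe_mem_of_map_act_eq S hN'Kc hact g Pc hPc) P hg
  -- COUNT
  have hcount := natCard_setOf_map_eq_eq_index_of_stabilizer_le (algebraMap F (AlgebraicClosure (w.adicCompletion F)))
    act Γ₁ Nn (S.M.map (homOfLE hN'Kc)) (S.M.map (homOfLE hN'K₁)) (S.M.map (homOfLE hle)) hX (hsep Kc) (hsep K₁)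
    hNact hNΓ₁ hp hq hqr P hfree
  -- re-ascribe to the ambient `Algebra F Ω` instance, then rewrite `u P = z`
  have hcount' : Nat.card {Q : AlgPoints (S.M.obj K₁) (AlgebraicClosure (w.adicCompletion F)) //
      AlgPoints.map (S.M.map (homOfLE hle)) Q = AlgPoints.map (S.M.map (homOfLE hN'Kc)) P} = Γ₁.index := hcount
  rw [hP] at hcount'
  rw [hcount', hΓ₁, Subgroup.relIndex]


end FullLemmas

/-- **STUB `stub_full : RecordNeatLevelFullFibres`** — ED. 5.2 (was MOD clause (7); hypothesis-free); record currency (M), row (b12) HOME desk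
«NEAT-FREE» (freeness of `Kc∕N′` on complex points from the record՚s (F2c) `torsionFree` + transport to `Ω`-points + orbit counting) —
**PROVED** (F0P5a-p02 (g3) desk 9ec35e90: `FullLemmas.natCard_fibre_map_eq_relIndex` over ★ p810908 line-freeness, u4 ★ `isLevelQuotient_holds`,
★ p810819 transport `ℂ → Ω`, ★ p810625 full-fibre count).
(print: Milne2005ShimuraVarieties, Prop. 3.1 (b), Lemma 5.13, Rem. 5.29 (c)) (print: Pink1990Compactification, 0.6, 3.3) -/
theorem stub_full : RecordNeatLevelFullFibres :=
  fun _F _ _ _ _ _ι₁ _Jstar _K₀ S hJ hJu Kc K₁ hle w z => FullLemmas.natCard_fibre_map_eq_relIndex S hJ hJu Kc K₁ hle w z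

end Edition5Desk
end Summit.HodgeConjecture.HodgeConjecture.Cruxes.HLiu418.F0D9opRoad2
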